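import Summits.QuantumFields.YangMills.Theorems.LuscherReductionTwistedTraceScalingRecordAnalytic
import Summits.QuantumFields.YangMills.Theorems.LuscherReductionTwistedTraceScalingBOKernel
import Summits.QuantumFields.YangMills.Theorems.LuscherReductionTwistedTraceScalingTubeFloorGlue
import Summits.QuantumFields.YangMills.Theorems.LuscherReductionRunningReductionUniformFloor
import Summits.QuantumFields.YangMills.Theorems.LuscherReductionOneSiteLevelsVariational
import HarnessLib

/-!
# (B-T) ⟸ a POINTWISE two-sided comparison of the Born–Oppenheimer kernel with the one-site gauge-averaged kernel
# (lane A of S-BASE, crux `TwistedTraceScaling` stmt-QuantumFields-20203, C4-CORE; design note `pub/ym-fleet/ym-luscher-20007-p1/COARSE-DESIGN.md` §24.10, §25)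

The brick (B-T) (`RecordAnalyticInput.hT`) is a statement about the quadratic form of the one-site kernel `boKernel β Ω` (`tubeForm_boFun_eq`, p651738) on
gauge-invariant amplitudes `φ̄` supported in the window `{orbitDist₁ < recordDelta1 L s β}`.  This file reduces it to a POINTWISE kernel statement:
if `|𝒦_β(u,u') − c(β)·K̃₁^{(L³β)}(u,u')| ≤ κ(β)·c(β)·K̃₁^{(L³β)}(u,u')` for all `u, u'` in the window (`K̃₁` = `avgKernel` of the ONE-SITE lattice at coupling
`L³β`), then `|T(boFun φ̄ Ω) − c·⟨φ̄, K_{L³β} φ̄⟩| ≤ κ·c·(⟨φ̄, K_{L³β} φ̄⟩ + λ₀(1, L³β)‖φ̄‖²)`, i.e. (B-T) with `σ := c/γ`.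
The two inputs that make the additive slack work: (i) `⟨|φ̄|, K |φ̄|⟩ ≤ λ₀‖φ̄‖²` for a gauge-invariant (NOT twist-invariant) `φ̄` supported near the trivial
orbit — by twist symmetrisation of the NONNEGATIVE function `|φ̄|` (`qform_twistSum_ge`: the 56 cross terms are `≥ 0`; `l2_twistSum`: disjoint supports) and the
variational bound for the physical function `twistSum |φ̄|`; (ii) `0 ≤ ⟨φ̄, K φ̄⟩` for every bounded measurable `φ̄` (Gram/Schur argument of `…PositivityGram`).
* §1 `qform_self_nonneg_of_bounded` — `0 ≤ ⟨ψ, K_β ψ⟩` for bounded measurable `ψ` (no physicality needed);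
* §2 `qform_abs_le_levelValue_zero_mul` — `⟨|φ|, K_β |φ|⟩ ≤ λ₀(L,β)·‖φ‖²` for gauge-invariant `φ` supported in `{orbitDist < δ}`, `Lδ < 2`;
* §3 `measurable_boKernel`, `abs_boKernel_le` — the BO kernel is jointly measurable and bounded;
* §4 ★★ `tubeForm_boFun_near_of_pointwise` (one `β`) and ★★ `hT_of_pointwise` (the `∀ᶠ β` form of `RecordAnalyticInput.hT` with `σ β := c β / recordGamma L Ω β`).
HONEST FRAMING: a reduction (Fubini + positivity bookkeeping); the pointwise kernel asymptotics is the OPEN Laplace content of (B-T); C4-CORE OPEN; stub of a child of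
the CONDITIONAL route R2b1; not infinite volume, not a gap, not Clay.
-/

set_option autoImplicit false

noncomputable section

open MeasureTheory Filter Topology Real
open scoped BigOperators
open Literature.MathematicalPhysics.QuantumFieldTheory
open Literature.MathematicalPhysics.QuantumLattice

namespace Summit.QuantumFields.YangMills.Theorems.FemtoTransferGap.TwoLattice.ConstTube

open Summit.QuantumFields.YangMills.Theorems.FemtoTransferGap
open Summit.QuantumFields.YangMills.Theorems.FemtoTransferGap.TwoLattice.Avg
open Summit.QuantumFields.YangMills.Theorems.FemtoTransferGap.TwoLattice.Stiff (LinkSpace)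

/-! ## §1 Nonnegativity of the transfer form for bounded measurable functions -/

/-- `0 ≤ ⟨ψ, K_β ψ⟩` for every bounded measurable `ψ` and `β ≥ 0` (the time-like coupling is a Gram kernel; exponential of a Gram kernel is positive
semi-definite). [cite: OsterwalderSeiler1978, §2] -/
theorem qform_self_nonneg_of_bounded {M : ℕ} [NeZero M] {β : ℝ} (hβ : 0 ≤ β) {ψ : GaugeConfig 3 M SU2 → ℝ} (hψm : Measurable ψ) {C : ℝ}
    (hC : ∀ U, |ψ U| ≤ C) : 0 ≤ qform su2Rep β ψ ψ := by
  haveI : SecondCountableTopology (Matrix (Fin 2) (Fin 2) ℂ) := inferInstanceAs (SecondCountableTopology (Fin 2 → Fin 2 → ℂ))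
  haveI : SecondCountableTopology SU2 := secondCountableTopology_su2
  have hC0 : 0 ≤ C := (abs_nonneg _).trans (hC fun _ => 1)
  have hw_cont : Continuous fun U : GaugeConfig 3 M SU2 => Real.exp (-(β / 2) * wilsonAction su2Rep U) :=
    Real.continuous_exp.comp (continuous_const.mul (continuous_wilsonAction su2Rep continuous_su2Rep))
  obtain ⟨W, hW⟩ := (isCompact_range hw_cont).bddAbove
  have hWle : ∀ U, Real.exp (-(β / 2) * wilsonAction su2Rep U) ≤ W := fun U => hW (Set.mem_range_self U)
  set Φ : GaugeConfig 3 M SU2 → ℝ := fun U => ψ U * Real.exp (-(β / 2) * wilsonAction su2Rep U) with hΦdef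
  have hΦm : Measurable Φ := hψm.mul hw_cont.measurable
  have hΦb : ∀ U, |Φ U| ≤ C * W := fun U => by
    rw [hΦdef, abs_mul, abs_of_pos (Real.exp_pos _)]
    exact mul_le_mul (hC U) (hWle U) (Real.exp_pos _).le hC0
  have hCW : 0 ≤ C * W := (abs_nonneg _).trans (hΦb fun _ => 1)
  have hgm : ∀ a, Measurable (suFeature 2 M a) := fun a => (continuous_suFeature M a).measurable
  have hgb : ∀ a U, |suFeature 2 M a U| ≤ 1 := abs_suFeature_le_one M
  have hTm : Measurable fun p : GaugeConfig 3 M SU2 × GaugeConfig 3 M SU2 => ∑ a, suFeature 2 M a p.1 * suFeature 2 M a p.2 := measurable_gram _ hgm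
  have hTb := fun p : GaugeConfig 3 M SU2 × GaugeConfig 3 M SU2 => abs_gram_le (suFeature 2 M) zero_le_one hgb p.1 p.2
  have hK : ∀ U V, ψ U * transferKernel su2Rep β U V * ψ V = Φ U * Real.exp (β * ∑ a, suFeature 2 M a U * suFeature 2 M a V) * Φ V := by
    intro U V
    rw [← timeCoupling_fundamentalRep_eq_gram, hΦdef]
    simp only [transferKernel]
    rw [show β * timeCoupling su2Rep U V - β / 2 * (wilsonAction su2Rep U + wilsonAction su2Rep V)
        = β * timeCoupling su2Rep U V + -(β / 2) * wilsonAction su2Rep U + -(β / 2) * wilsonAction su2Rep V by ring, Real.exp_add, Real.exp_add]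
    ring
  have hint : Integrable (fun p : GaugeConfig 3 M SU2 × GaugeConfig 3 M SU2 => Φ p.1 * Real.exp (β * ∑ a, suFeature 2 M a p.1 * suFeature 2 M a p.2) * Φ p.2)
      ((configMeasure _ M).prod (configMeasure _ M)) := by
    refine integrable_sandwich (configMeasure _ M) (H := fun p => Real.exp (β * ∑ a, suFeature 2 M a p.1 * suFeature 2 M a p.2)) (hTm.const_mul β).exp
      (R := Real.exp (β * (Fintype.card (Edge 3 M × (Fin 2 × Fin 2) × Bool) * 1 ^ 2))) (fun p => ?_) hΦm hΦb
    show |Real.exp (β * ∑ a, suFeature 2 M a p.1 * suFeature 2 M a p.2)| ≤ _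
    rw [abs_of_pos (Real.exp_pos _)]
    refine Real.exp_le_exp.mpr ?_
    exact (le_abs_self _).trans (by rw [abs_mul, abs_of_nonneg hβ]; exact mul_le_mul_of_nonneg_left (hTb p) hβ)
  have hq : qform su2Rep β ψ ψ = ∫ p, Φ p.1 * Real.exp (β * ∑ a, suFeature 2 M a p.1 * suFeature 2 M a p.2) * Φ p.2 ∂(configMeasure _ M).prod (configMeasure _ M) := by
    unfold qform
    simp_rw [hK]
    exact (integral_prod _ hint).symm
  rw [hq]
  exact integral_prod_exp_gram_nonneg (configMeasure SU2 M) (suFeature 2 M) hgm zero_le_one hgb Φ hΦm hCW hΦb hβ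

/-! ## §2 The top bound for the modulus of a gauge-invariant function supported near the trivial orbit -/

/-- `⟨|φ|, K_β |φ|⟩ ≤ λ₀(L, β)·‖φ‖²` for `φ` bounded measurable gauge invariant supported in `{orbitDist < δ}` with `L·δ < 2` (twist symmetrisation of `|φ| ≥ 0`:
`8⟨|φ|,K|φ|⟩ ≤ ⟨Σ|φ|, KΣ|φ|⟩ ≤ λ₀‖Σ|φ|‖² = 8λ₀‖φ‖²`). [cite: ReedSimonIV1978, Thm. XIII.1] -/
theorem qform_abs_le_levelValue_zero_mul {M : ℕ} [NeZero M] {β : ℝ} (hβ : 0 ≤ β) {φ : GaugeConfig 3 M SU2 → ℝ} (hφm : Measurable φ) {C : ℝ}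
    (hC : ∀ U, |φ U| ≤ C) (hφg : ∀ (g : Site 3 M → SU2) (U : GaugeConfig 3 M SU2), φ (gaugeTransform g U) = φ U) {δ : ℝ} (hMδ : (M : ℝ) * δ < 2)
    (hsupp : ∀ U, φ U ≠ 0 → orbitDist U < δ) :
    qform su2Rep β (fun U => |φ U|) (fun U => |φ U|) ≤ levelValue su2Rep M β 0 * l2 φ φ := by
  set a : GaugeConfig 3 M SU2 → ℝ := fun U => |φ U| with ha
  have ham : Measurable a := hφm.abs
  have haC : ∀ U, |a U| ≤ C := fun U => by rw [ha]; dsimp only; rw [abs_abs]; exact hC U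
  have ha0 : ∀ U, 0 ≤ a U := fun U => abs_nonneg _
  have hag : ∀ (g : Site 3 M → SU2) (U : GaugeConfig 3 M SU2), a (gaugeTransform g U) = a U := fun g U => by simp only [ha, hφg]
  have hasupp : ∀ U, a U ≠ 0 → orbitDist U < δ := fun U h => hsupp U (by intro h0; exact h (by simp [ha, h0]))
  have hl2a : l2 a a = l2 φ φ := by
    unfold l2; refine integral_congr_ae (ae_of_all _ fun U => ?_); simp only [ha]; rw [← sq, sq_abs, sq]
  have hphys : IsPhys (twistSum a) := isPhys_twistSum ham ⟨C, haC⟩ hag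
  have h8q : 8 * qform su2Rep β a a ≤ qform su2Rep β (twistSum a) (twistSum a) := qform_twistSum_ge hβ ham haC ha0
  have h8l : l2 (twistSum a) (twistSum a) = 8 * l2 a a := l2_twistSum ham haC hMδ hasupp
  have hl2nn : 0 ≤ l2 φ φ := by rw [l2_self_eq_integral_sq]; exact integral_nonneg fun U => sq_nonneg _
  rcases hl2nn.lt_or_eq with hpos | hzero
  · have hpos' : 0 < l2 (twistSum a) (twistSum a) := by rw [h8l, hl2a]; linarith
    have htop := qform_le_levelValue_zero_mul su2Rep continuous_su2Rep β hphys hpos'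
    rw [h8l, hl2a] at htop
    linarith
  · -- `‖φ‖ = 0`: both sides vanish
    have h0 : ∫ U, a U ^ 2 ∂configMeasure SU2 M = 0 := by rw [← l2_self_eq_integral_sq, hl2a, ← hzero]
    rw [qform_eq_zero_of_integral_sq_eq_zero β ham haC h0, ← hzero, mul_zero]

/-! ## §3 The BO kernel is jointly measurable and bounded -/

variable {L : ℕ} [NeZero L]

/-- The integrand `((u,u'), v, v') ↦ Ω(v)·K̃_β(orthoTube u v, orthoTube u' v')·Ω(v')` is jointly measurable. [folklore] -/
theorem measurable_boKernel_integrand (β : ℝ) {Ω : LinkSpace L → ℝ} (hΩ : Measurable Ω) :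
    Measurable fun q : (GaugeConfig 3 1 SU2 × GaugeConfig 3 1 SU2) × (Edge 3 L → Fin 3 → ℝ) × (Edge 3 L → Fin 3 → ℝ) =>
      Ω (linkEmbed L q.2.1) * (avgKernel β (orthoTube L q.1.1 q.2.1) (orthoTube L q.1.2 q.2.2) * Ω (linkEmbed L q.2.2)) := by
  have hΩ1 : Measurable fun q : (GaugeConfig 3 1 SU2 × GaugeConfig 3 1 SU2) × (Edge 3 L → Fin 3 → ℝ) × (Edge 3 L → Fin 3 → ℝ) => Ω (linkEmbed L q.2.1) :=
    hΩ.comp ((measurable_linkEmbed L).comp (measurable_fst.comp measurable_snd))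
  have hΩ2 : Measurable fun q : (GaugeConfig 3 1 SU2 × GaugeConfig 3 1 SU2) × (Edge 3 L → Fin 3 → ℝ) × (Edge 3 L → Fin 3 → ℝ) => Ω (linkEmbed L q.2.2) :=
    hΩ.comp ((measurable_linkEmbed L).comp (measurable_snd.comp measurable_snd))
  have hpair : Measurable fun q : (GaugeConfig 3 1 SU2 × GaugeConfig 3 1 SU2) × (Edge 3 L → Fin 3 → ℝ) × (Edge 3 L → Fin 3 → ℝ) =>
      (orthoTube L q.1.1 q.2.1, orthoTube L q.1.2 q.2.2) := by
    refine Measurable.prodMk ?_ ?_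
    · have h1 : Measurable fun q : (GaugeConfig 3 1 SU2 × GaugeConfig 3 1 SU2) × (Edge 3 L → Fin 3 → ℝ) × (Edge 3 L → Fin 3 → ℝ) => (q.1.1, q.2.1) :=
        (measurable_fst.comp measurable_fst).prodMk (measurable_fst.comp measurable_snd)
      have h := (measurable_orthoTube L).comp h1
      simpa only [Function.comp_def] using h
    · have h1 : Measurable fun q : (GaugeConfig 3 1 SU2 × GaugeConfig 3 1 SU2) × (Edge 3 L → Fin 3 → ℝ) × (Edge 3 L → Fin 3 → ℝ) => (q.1.2, q.2.2) :=
        (measurable_snd.comp measurable_fst).prodMk (measurable_snd.comp measurable_snd)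
      have h := (measurable_orthoTube L).comp h1
      simpa only [Function.comp_def] using h
  have hK := (measurable_avgKernel (L := L) β).comp hpair
  have hK' : Measurable fun q : (GaugeConfig 3 1 SU2 × GaugeConfig 3 1 SU2) × (Edge 3 L → Fin 3 → ℝ) × (Edge 3 L → Fin 3 → ℝ) =>
      avgKernel β (orthoTube L q.1.1 q.2.1) (orthoTube L q.1.2 q.2.2) := by
    simpa only [Function.comp_def] using hK
  exact hΩ1.mul (hK'.mul hΩ2)

/-- **The BO kernel is jointly measurable** in `(u, u')`. [folklore] -/
theorem measurable_boKernel (β : ℝ) {Ω : LinkSpace L → ℝ} (hΩ : Measurable Ω) :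
    Measurable fun p : GaugeConfig 3 1 SU2 × GaugeConfig 3 1 SU2 => boKernel L β Ω p.1 p.2 := by
  haveI := isFiniteMeasure_orthoTransverse L
  have h3 := measurable_boKernel_integrand (L := L) β hΩ
  -- integrate out `v'`
  have h3' : Measurable fun r : ((GaugeConfig 3 1 SU2 × GaugeConfig 3 1 SU2) × (Edge 3 L → Fin 3 → ℝ)) × (Edge 3 L → Fin 3 → ℝ) =>
      Ω (linkEmbed L r.1.2) * (avgKernel β (orthoTube L r.1.1.1 r.1.2) (orthoTube L r.1.1.2 r.2) * Ω (linkEmbed L r.2)) := by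
    have hr : Measurable fun r : ((GaugeConfig 3 1 SU2 × GaugeConfig 3 1 SU2) × (Edge 3 L → Fin 3 → ℝ)) × (Edge 3 L → Fin 3 → ℝ) => (r.1.1, (r.1.2, r.2)) :=
      (measurable_fst.comp measurable_fst).prodMk ((measurable_snd.comp measurable_fst).prodMk measurable_snd)
    have h := h3.comp hr
    simpa only [Function.comp_def] using h
  have h2 : Measurable fun q : (GaugeConfig 3 1 SU2 × GaugeConfig 3 1 SU2) × (Edge 3 L → Fin 3 → ℝ) =>
      ∫ v', Ω (linkEmbed L q.2) * (avgKernel β (orthoTube L q.1.1 q.2) (orthoTube L q.1.2 v') * Ω (linkEmbed L v')) ∂orthoTransverse L := by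
    have h := (h3'.stronglyMeasurable.integral_prod_right' (ν := orthoTransverse L)).measurable
    simpa only using h
  have h2e : (fun q : (GaugeConfig 3 1 SU2 × GaugeConfig 3 1 SU2) × (Edge 3 L → Fin 3 → ℝ) =>
      ∫ v', Ω (linkEmbed L q.2) * (avgKernel β (orthoTube L q.1.1 q.2) (orthoTube L q.1.2 v') * Ω (linkEmbed L v')) ∂orthoTransverse L) =
      fun q => Ω (linkEmbed L q.2) * ∫ v', avgKernel β (orthoTube L q.1.1 q.2) (orthoTube L q.1.2 v') * Ω (linkEmbed L v') ∂orthoTransverse L := by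
    funext q; rw [integral_const_mul]
  rw [h2e] at h2
  have h1 := (h2.stronglyMeasurable.integral_prod_right' (ν := orthoTransverse L)).measurable
  unfold boKernel
  simpa only using h1

/-- For fixed `u`, `u' ↦ 𝒦_β(u,u')` is measurable. [folklore] -/
theorem measurable_boKernel_right (β : ℝ) {Ω : LinkSpace L → ℝ} (hΩ : Measurable Ω) (u : GaugeConfig 3 1 SU2) :
    Measurable fun u' : GaugeConfig 3 1 SU2 => boKernel L β Ω u u' := by
  have hp : Measurable fun u' : GaugeConfig 3 1 SU2 => ((u, u') : GaugeConfig 3 1 SU2 × GaugeConfig 3 1 SU2) := measurable_const.prodMk measurable_id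
  have h := (measurable_boKernel (L := L) β hΩ).comp hp
  simpa only [Function.comp_def] using h

/-- **The BO kernel is bounded**: `|𝒦_β(u,u')| ≤ M·C_Ω²·π(univ)²` with `K̃_β ≤ M`. [folklore] -/
theorem abs_boKernel_le (β : ℝ) {Ω : LinkSpace L → ℝ} {CΩ : ℝ} (hCΩ : ∀ x, |Ω x| ≤ CΩ) :
    ∃ B : ℝ, 0 ≤ B ∧ ∀ u u' : GaugeConfig 3 1 SU2, |boKernel L β Ω u u'| ≤ B := by
  haveI := isFiniteMeasure_orthoTransverse L
  obtain ⟨M, hM0, hM⟩ := exists_avgKernel_le (L := L) β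
  have hCΩ0 : 0 ≤ CΩ := (abs_nonneg _).trans (hCΩ 0)
  set P : ℝ := (orthoTransverse L).real Set.univ with hP
  have hP0 : 0 ≤ P := measureReal_nonneg
  refine ⟨CΩ * (M * CΩ * P) * P, by positivity, fun u u' => ?_⟩
  have hinner : ∀ v : Edge 3 L → Fin 3 → ℝ, |∫ v', avgKernel β (orthoTube L u v) (orthoTube L u' v') * Ω (linkEmbed L v') ∂orthoTransverse L| ≤ M * CΩ * P := fun v => by
    calc |∫ v', avgKernel β (orthoTube L u v) (orthoTube L u' v') * Ω (linkEmbed L v') ∂orthoTransverse L|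
        ≤ ∫ v', |avgKernel β (orthoTube L u v) (orthoTube L u' v') * Ω (linkEmbed L v')| ∂orthoTransverse L := abs_integral_le_integral_abs
      _ ≤ ∫ _v', M * CΩ ∂orthoTransverse L := by
          refine integral_mono_of_nonneg (ae_of_all _ fun _ => abs_nonneg _) (integrable_const _) (ae_of_all _ fun v' => ?_)
          show |avgKernel β (orthoTube L u v) (orthoTube L u' v') * Ω (linkEmbed L v')| ≤ M * CΩ
          rw [abs_mul, abs_of_pos (avgKernel_pos β _ _)]
          exact mul_le_mul (hM _ _) (hCΩ _) (abs_nonneg _) hM0.le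
      _ = M * CΩ * P := by rw [integral_const, smul_eq_mul, hP]; ring
  unfold boKernel
  calc |∫ v, Ω (linkEmbed L v) * ∫ v', avgKernel β (orthoTube L u v) (orthoTube L u' v') * Ω (linkEmbed L v') ∂orthoTransverse L ∂orthoTransverse L|
      ≤ ∫ v, |Ω (linkEmbed L v) * ∫ v', avgKernel β (orthoTube L u v) (orthoTube L u' v') * Ω (linkEmbed L v') ∂orthoTransverse L| ∂orthoTransverse L :=
        abs_integral_le_integral_abs
    _ ≤ ∫ _v, CΩ * (M * CΩ * P) ∂orthoTransverse L := by
        refine integral_mono_of_nonneg (ae_of_all _ fun _ => abs_nonneg _) (integrable_const _) (ae_of_all _ fun v => ?_)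
        show |Ω (linkEmbed L v) * ∫ v', avgKernel β (orthoTube L u v) (orthoTube L u' v') * Ω (linkEmbed L v') ∂orthoTransverse L| ≤ CΩ * (M * CΩ * P)
        rw [abs_mul]
        exact mul_le_mul (hCΩ _) (hinner v) (abs_nonneg _) hCΩ0
    _ = CΩ * (M * CΩ * P) * P := by rw [integral_const, smul_eq_mul, hP]; ring

/-! ## §4 ★★ (B-T) from the pointwise kernel comparison -/

/-- The one-site transfer form of a gauge-invariant bounded measurable `φ` in row form: `⟨φ, K_B φ⟩ = ∫ φ(u)·(∫ K̃₁^{(B)}(u,u') φ(u') du') du`. [cite: SeilerLNP1982, §3] -/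
theorem qform_eq_integral_avgKernel_of_invariant {M : ℕ} [NeZero M] (B : ℝ) {φ : GaugeConfig 3 M SU2 → ℝ} (hφm : Measurable φ) {C : ℝ} (hC : ∀ U, |φ U| ≤ C)
    (hφg : ∀ (g : Site 3 M → SU2) (U : GaugeConfig 3 M SU2), φ (gaugeTransform g U) = φ U) :
    qform su2Rep B φ φ = ∫ u, φ u * (∫ u', avgKernel B u u' * φ u' ∂configMeasure SU2 M) ∂configMeasure SU2 M := by
  have hga : gaugeAvg φ = φ := by funext U; exact gaugeAvg_of_invariant hφg U
  have h := qform_gaugeAvg_eq_tubeForm B hφm hC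
  rw [hga] at h
  rw [h, tubeForm_eq_integral_mul]

/-- ★★ **(B-T) at one `β` from the pointwise kernel comparison.**  If `|𝒦_β(u,u') − c·K̃₁^{(B)}(u,u')| ≤ κ·c·K̃₁^{(B)}(u,u')` for all `u, u'` in `{orbitDist < δ}`
(`B ≥ 0`, `c, κ ≥ 0`, `δ < 2`), then for every gauge-invariant bounded measurable `φ` supported there
`|T(boFun φ Ω) − c·⟨φ, K_B φ⟩| ≤ κ·c·(⟨φ, K_B φ⟩ + λ₀(1,B)·‖φ‖²)`. [cite: Luscher1983, §3] -/
theorem tubeForm_boFun_near_of_pointwise (β : ℝ) {B : ℝ} (hB : 0 ≤ B) {Ω : LinkSpace L → ℝ} (hΩ : Measurable Ω) {CΩ : ℝ} (hCΩ : ∀ x, |Ω x| ≤ CΩ)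
    {c κ δ : ℝ} (hc : 0 ≤ c) (hκ : 0 ≤ κ) (hδ : δ < 2)
    (hpt : ∀ u u' : GaugeConfig 3 1 SU2, orbitDist u < δ → orbitDist u' < δ →
      |boKernel L β Ω u u' - c * avgKernel B u u'| ≤ κ * c * avgKernel B u u')
    {φ : GaugeConfig 3 1 SU2 → ℝ} (hφm : Measurable φ) {Cφ : ℝ} (hCφ : ∀ u, |φ u| ≤ Cφ)
    (hφg : ∀ (g : Site 3 1 → SU2) (u : GaugeConfig 3 1 SU2), φ (gaugeTransform g u) = φ u) (hsupp : ∀ u, φ u ≠ 0 → orbitDist u < δ) :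
    |tubeForm β (boFun L φ Ω) - c * qform su2Rep B φ φ| ≤ κ * c * (qform su2Rep B φ φ + levelValue su2Rep 1 B 0 * l2 φ φ) := by
  have hCφ0 : 0 ≤ Cφ := (abs_nonneg _).trans (hCφ 1)
  obtain ⟨MB, hMB0, hMB⟩ := exists_avgKernel_le (L := 1) B
  obtain ⟨KB, hKB0, hKB⟩ := abs_boKernel_le (L := L) β hCΩ
  -- the three row functions
  set A : GaugeConfig 3 1 SU2 → ℝ := fun u => ∫ u', boKernel L β Ω u u' * φ u' ∂configMeasure SU2 1 with hA
  set R : GaugeConfig 3 1 SU2 → ℝ := fun u => ∫ u', avgKernel B u u' * φ u' ∂configMeasure SU2 1 with hR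
  set Rabs : GaugeConfig 3 1 SU2 → ℝ := fun u => ∫ u', avgKernel B u u' * |φ u'| ∂configMeasure SU2 1 with hRabs
  have hT : tubeForm β (boFun L φ Ω) = ∫ u, φ u * A u ∂configMeasure SU2 1 := tubeForm_boFun_eq β hφm hCφ hΩ hCΩ
  have hQ : qform su2Rep B φ φ = ∫ u, φ u * R u ∂configMeasure SU2 1 := qform_eq_integral_avgKernel_of_invariant B hφm hCφ hφg
  have hφam : Measurable fun u => |φ u| := hφm.abs
  have hφaC : ∀ u, |(fun u => |φ u|) u| ≤ Cφ := fun u => by dsimp only; rw [abs_abs]; exact hCφ u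
  have hφag : ∀ (g : Site 3 1 → SU2) (u : GaugeConfig 3 1 SU2), (fun u => |φ u|) (gaugeTransform g u) = (fun u => |φ u|) u := fun g u => by
    simp only [hφg]
  have hQabs : qform su2Rep B (fun u => |φ u|) (fun u => |φ u|) = ∫ u, |φ u| * Rabs u ∂configMeasure SU2 1 :=
    qform_eq_integral_avgKernel_of_invariant B hφam hφaC hφag
  -- integrability of the rows
  have hintA : ∀ u, Integrable (fun u' => boKernel L β Ω u u' * φ u') (configMeasure SU2 1) := fun u =>
    integrable_of_measurable_abs_le _ ((measurable_boKernel_right (L := L) β hΩ u).mul hφm) (C := KB * Cφ) fun u' => by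
      rw [abs_mul]; exact mul_le_mul (hKB u u') (hCφ u') (abs_nonneg _) hKB0
  have hintR : ∀ u, Integrable (fun u' => avgKernel B u u' * φ u') (configMeasure SU2 1) := fun u =>
    integrable_of_measurable_abs_le _ ((measurable_avgKernel_right B u).mul hφm) (C := MB * Cφ) fun u' => by
      rw [abs_mul, abs_of_pos (avgKernel_pos B _ _)]; exact mul_le_mul (hMB u u') (hCφ u') (abs_nonneg _) hMB0.le
  have hintRabs : ∀ u, Integrable (fun u' => avgKernel B u u' * |φ u'|) (configMeasure SU2 1) := fun u =>
    integrable_of_measurable_abs_le _ ((measurable_avgKernel_right B u).mul hφam) (C := MB * Cφ) fun u' => by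
      rw [abs_mul, abs_of_pos (avgKernel_pos B _ _), abs_abs]; exact mul_le_mul (hMB u u') (hCφ u') (abs_nonneg _) hMB0.le
  -- pointwise row estimate: `|φ(u)| · |A(u) − c R(u)| ≤ κ c |φ(u)| Rabs(u)`
  have hrow : ∀ u, |φ u * A u - c * (φ u * R u)| ≤ κ * c * (|φ u| * Rabs u) := by
    intro u
    by_cases hu : φ u = 0
    · simp [hu]
    have hud : orbitDist u < δ := hsupp u hu
    have e1 : φ u * A u - c * (φ u * R u) = φ u * ∫ u', (boKernel L β Ω u u' - c * avgKernel B u u') * φ u' ∂configMeasure SU2 1 := by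
      rw [hA, hR]; dsimp only
      rw [show (fun u' => (boKernel L β Ω u u' - c * avgKernel B u u') * φ u') = fun u' => boKernel L β Ω u u' * φ u' - c * (avgKernel B u u' * φ u') by
        funext u'; ring, integral_sub (hintA u) ((hintR u).const_mul c), integral_const_mul]
      ring
    have hI : |∫ u', (boKernel L β Ω u u' - c * avgKernel B u u') * φ u' ∂configMeasure SU2 1| ≤ κ * c * Rabs u := by
      calc |∫ u', (boKernel L β Ω u u' - c * avgKernel B u u') * φ u' ∂configMeasure SU2 1|
          ≤ ∫ u', |(boKernel L β Ω u u' - c * avgKernel B u u') * φ u'| ∂configMeasure SU2 1 := abs_integral_le_integral_abs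
        _ ≤ ∫ u', κ * c * (avgKernel B u u' * |φ u'|) ∂configMeasure SU2 1 := by
            refine integral_mono_of_nonneg (ae_of_all _ fun _ => abs_nonneg _) ((hintRabs u).const_mul _) (ae_of_all _ fun u' => ?_)
            show |(boKernel L β Ω u u' - c * avgKernel B u u') * φ u'| ≤ κ * c * (avgKernel B u u' * |φ u'|)
            by_cases hu' : φ u' = 0
            · simp [hu']
            rw [abs_mul, ← mul_assoc]
            exact mul_le_mul_of_nonneg_right (hpt u u' hud (hsupp u' hu')) (abs_nonneg _)
        _ = κ * c * Rabs u := by rw [integral_const_mul]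
    rw [e1, abs_mul]
    calc |φ u| * |∫ u', (boKernel L β Ω u u' - c * avgKernel B u u') * φ u' ∂configMeasure SU2 1| ≤ |φ u| * (κ * c * Rabs u) :=
          mul_le_mul_of_nonneg_left hI (abs_nonneg _)
      _ = κ * c * (|φ u| * Rabs u) := by ring
  -- integrate the row estimate
  have hintφA : Integrable (fun u => φ u * A u) (configMeasure SU2 1) := by
    have hAm : Measurable A := by
      have hF : Measurable fun p : GaugeConfig 3 1 SU2 × GaugeConfig 3 1 SU2 => boKernel L β Ω p.1 p.2 * φ p.2 :=
        (measurable_boKernel (L := L) β hΩ).mul (hφm.comp measurable_snd)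
      have h := (hF.stronglyMeasurable.integral_prod_right' (ν := configMeasure SU2 1)).measurable
      rw [hA]; simpa only using h
    refine integrable_of_measurable_abs_le _ (hφm.mul hAm) (C := Cφ * (KB * Cφ)) fun u => ?_
    rw [abs_mul]
    refine mul_le_mul (hCφ u) ?_ (abs_nonneg _) hCφ0
    calc |A u| ≤ ∫ u', |boKernel L β Ω u u' * φ u'| ∂configMeasure SU2 1 := abs_integral_le_integral_abs
      _ ≤ ∫ _u', KB * Cφ ∂configMeasure SU2 1 :=
          integral_mono_of_nonneg (ae_of_all _ fun _ => abs_nonneg _) (integrable_const _) (ae_of_all _ fun u' => by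
            show |boKernel L β Ω u u' * φ u'| ≤ KB * Cφ
            rw [abs_mul]; exact mul_le_mul (hKB u u') (hCφ u') (abs_nonneg _) hKB0)
      _ = KB * Cφ := by simp
  have hintφR : Integrable (fun u => φ u * R u) (configMeasure SU2 1) := integrable_mul_integral_avgKernel B hφm hCφ hφm hCφ
  have hintφRabs : Integrable (fun u => |φ u| * Rabs u) (configMeasure SU2 1) := integrable_mul_integral_avgKernel B hφam hφaC hφam hφaC
  have hdiff : tubeForm β (boFun L φ Ω) - c * qform su2Rep B φ φ = ∫ u, (φ u * A u - c * (φ u * R u)) ∂configMeasure SU2 1 := by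
    rw [hT, hQ, ← integral_const_mul, ← integral_sub hintφA (hintφR.const_mul c)]
  have habs : |tubeForm β (boFun L φ Ω) - c * qform su2Rep B φ φ| ≤ κ * c * qform su2Rep B (fun u => |φ u|) (fun u => |φ u|) := by
    rw [hdiff, hQabs, ← integral_const_mul]
    calc |∫ u, (φ u * A u - c * (φ u * R u)) ∂configMeasure SU2 1| ≤ ∫ u, |φ u * A u - c * (φ u * R u)| ∂configMeasure SU2 1 := abs_integral_le_integral_abs
      _ ≤ ∫ u, κ * c * (|φ u| * Rabs u) ∂configMeasure SU2 1 :=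
          integral_mono_of_nonneg (ae_of_all _ fun _ => abs_nonneg _) (hintφRabs.const_mul _) (ae_of_all _ hrow)
  -- the top bound and nonnegativity
  have htop : qform su2Rep B (fun u => |φ u|) (fun u => |φ u|) ≤ levelValue su2Rep 1 B 0 * l2 φ φ :=
    qform_abs_le_levelValue_zero_mul hB hφm hCφ hφg (by simpa using hδ) hsupp
  have hnn : 0 ≤ qform su2Rep B φ φ := qform_self_nonneg_of_bounded hB hφm hCφ
  have hκc : 0 ≤ κ * c := mul_nonneg hκ hc
  calc |tubeForm β (boFun L φ Ω) - c * qform su2Rep B φ φ| ≤ κ * c * qform su2Rep B (fun u => |φ u|) (fun u => |φ u|) := habs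
    _ ≤ κ * c * (levelValue su2Rep 1 B 0 * l2 φ φ) := mul_le_mul_of_nonneg_left htop hκc
    _ ≤ κ * c * (qform su2Rep B φ φ + levelValue su2Rep 1 B 0 * l2 φ φ) := mul_le_mul_of_nonneg_left (by linarith) hκc

/-- ★★ **(B-T) FROM THE POINTWISE KERNEL COMPARISON** (the `∀ᶠ β` form of `RecordAnalyticInput.hT` with `σ β := c β / recordGamma L Ω β`).  Hypotheses: `Ω β` measurable
with `|Ω| ≤ 1`, `recordGamma L Ω β > 0`, `c, κ ≥ 0`, `s > 0`, and eventually the two-sided pointwise comparison of `boKernel β (Ω β)` with `c β · K̃₁^{(L³β)}` on the window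
`{orbitDist₁ < recordDelta1 L s β}`. [cite: Luscher1983, §3] -/
theorem hT_of_pointwise {s : ℝ} (hs : 0 < s) {Ω : ℝ → LinkSpace L → ℝ} (hΩm : ∀ β, Measurable (Ω β)) (hΩ1 : ∀ β x, |Ω β x| ≤ 1)
    (hγ : ∀ β, 0 < recordGamma L Ω β) {c κ : ℝ → ℝ} (hc : ∀ β, 0 ≤ c β) (hκ : ∀ β, 0 ≤ κ β)
    (hpt : ∀ᶠ β : ℝ in atTop, ∀ u u' : GaugeConfig 3 1 SU2, orbitDist u < recordDelta1 L s β → orbitDist u' < recordDelta1 L s β →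
      |boKernel L β (Ω β) u u' - c β * avgKernel ((L : ℝ) ^ 3 * β) u u'| ≤ κ β * c β * avgKernel ((L : ℝ) ^ 3 * β) u u') :
    ∀ᶠ β : ℝ in atTop, ∀ φ : GaugeConfig 3 1 SU2 → ℝ, Measurable φ → (∃ C : ℝ, ∀ u, |φ u| ≤ C) →
      (∀ (g : Site 3 1 → SU2) (u : GaugeConfig 3 1 SU2), φ (gaugeTransform g u) = φ u) → (∀ u, φ u ≠ 0 → orbitDist u < recordDelta1 L s β) →
      |tubeForm β (boFun L φ (Ω β)) - (c β / recordGamma L Ω β) * recordGamma L Ω β * qform su2Rep ((L : ℝ) ^ 3 * β) φ φ| ≤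
        κ β * ((c β / recordGamma L Ω β) * recordGamma L Ω β) *
          (qform su2Rep ((L : ℝ) ^ 3 * β) φ φ + levelValue su2Rep 1 ((L : ℝ) ^ 3 * β) 0 * l2 φ φ) := by
  have hδ := recordDelta1_le_half (L := L) hs
  filter_upwards [hpt, hδ, eventually_ge_atTop (0 : ℝ)] with β hβ hδβ hβ0 φ hφm hφb hφg hsupp
  obtain ⟨Cφ, hCφ⟩ := hφb
  have hcγ : c β / recordGamma L Ω β * recordGamma L Ω β = c β := div_mul_cancel₀ _ (hγ β).ne'
  rw [hcγ]
  have hB : 0 ≤ (L : ℝ) ^ 3 * β := by positivity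
  exact tubeForm_boFun_near_of_pointwise β hB (hΩm β) (hΩ1 β) (hc β) (hκ β) (by linarith) hβ hφm hCφ hφg hsupp

end Summit.QuantumFields.YangMills.Theorems.FemtoTransferGap.TwoLattice.ConstTube

end
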